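import Literature.Algebra.Homology.CharpolyHomologyShortComplex
import Literature.Algebra.Homology.EulerPoincarePrinciple
import Mathlib.FieldTheory.RatFunc.AsPolynomial
import HarnessLib

/-!
# The characteristic-polynomial Euler–Poincaré identity of an endomorphism of a complex (LEAF 2 of the charpoly twin)

Layer `Literature/Algebra/Homology` (pure linear algebra over Mathlib; proved theorems only, 0 definitions, 0 named facts, no
instances, no notation). For an endomorphism `φ : C ⟶ C` of a homological complex of finite-dimensional vector spaces over a field
`K`, of ANY shape `c` with `ComplexShape.EulerCharSigns` and finitely many non-zero terms, write `χ(u) ∈ K[X]` for the characteristic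
polynomial of an endomorphism `u`. Then (Lang, *Algebra* XX §3, Thm. 3.1, for the Euler–Poincaré map `u ↦ χ(u) ∈ K(X)ˣ` — row
`EulerPoincarePrinciple`; the shape of `Z(X, t) = ∏ᵣ Pᵣ(t)^{(−1)^{r+1}}`, `Pᵣ = det(1 − Ft | Hʳ)`):

* `charpoly_eq_one_of_subsingleton`, `charpoly_restrict_range_d_eq_one` — the boundary factor `χ(φⱼ | im d(i, j))` is `1` off `c.Rel`;
  `subsingleton_homology_of_subsingleton` — `Hⁱ = 0` where `Cⁱ = 0`;
* `charpoly_f_eq` — degreewise, LEAF 1 (`charpoly_τ₂_eq`) on `C.sc i`: `χ(φᵢ) = χ(H(φ)ᵢ) · χ(φ_{next i} | im d(i, next i)) · χ(φᵢ | im d(prev i, i))`;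
* **`finprod_charpoly_zpow_χ_eq : ∏ᶠ i, χ(φᵢ)^{χ(i)} = ∏ᶠ i, χ(H(φ)ᵢ)^{χ(i)}`** in the rational function field `RatFunc K` (`χ(i) = ±1` as
  `ℤ`-powers): row `EulerPoincarePrinciple`'s `finprod_zpow_χ_eq_of_degreewise` in the group `(RatFunc K)ˣ`, fed by `charpoly_f_eq`;
* its `Finset` form `prod_charpoly_zpow_χ_eq` and the `ℤ`-indexed cochain form `CochainComplex.prod_charpoly_zpow_negOnePow_eq`
  (`∏_{n ∈ [a,b]} χ(φⁿ)^{(−1)ⁿ} = ∏_{n ∈ [a,b]} χ(Hⁿ(φ))^{(−1)ⁿ}`).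

Taking `nextCoeff` (resp. `natDegree`) gives row `HopfTraceFormula` (resp. row `EulerPoincareFormula`); neither is restated or re-derived.
Library only (cell `pub-hodge-ring2`, count-neutral); proves nothing about any crux, route or conjecture.

## References

* S. Lang, *Algebra* (2002), Ch. XX §3, Thm. 3.1 (Euler–Poincaré maps: `χ_φ(E) = χ_φ(H(E))`). [Lang2002]
* N. Bourbaki, *Algèbre, Chapitre VIII* (2012), §20 n°6, p. 377 (`χ_E(a;T)` is multiplicative in exact sequences). [BourbakiAlgebreVIII2012]
* A. Hatcher, *Algebraic Topology* (2002), §2.C, Thm. 2C.3 (the pattern of proof). [HatcherAT2002]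
-/

open CategoryTheory CategoryTheory.Limits Polynomial

universe v u w

namespace Literature.Algebra.Homology.HopfTrace

variable {K : Type u} [Field K]

/-- The characteristic polynomial of an endomorphism of the zero space is `1`. [cite: BourbakiAlgebreVIII2012, VIII §20 n°6 (p. 377)] -/
theorem charpoly_eq_one_of_subsingleton {M : Type*} [AddCommGroup M] [Module K M] [Module.Finite K M] [Subsingleton M]
    (f : M →ₗ[K] M) : f.charpoly = 1 :=
  f.charpoly_monic.natDegree_eq_zero.1 (by rw [f.charpoly_natDegree, Module.finrank_zero_of_subsingleton])

variable {ι : Type w} {c : ComplexShape ι} (C : HomologicalComplex (ModuleCat.{v} K) c) (φ : C ⟶ C)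

/-! ### Degreewise -/

/-- The boundary factor `χ(φⱼ | im d(i, j))` is `1` when `i`, `j` are not related (then `d(i, j) = 0`).
[cite: HatcherAT2002, Thm. 2C.3 (proof)] -/
theorem charpoly_restrict_range_d_eq_one (i j : ι) (h : ¬c.Rel i j) [Module.Finite K (C.X j)] :
    ((φ.f j).hom.restrict (mapsTo_range_d C φ i j)).charpoly = 1 := by
  haveI : Subsingleton (LinearMap.range (C.d i j).hom) := by
    rw [C.shape _ _ h, ModuleCat.hom_zero, LinearMap.range_zero]
    infer_instance
  exact charpoly_eq_one_of_subsingleton _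

/-- Where `Cⁱ = 0`, so is `Hⁱ(C)` (`dim Hⁱ ≤ dim Cⁱ`, row `EulerPoincareFormula`). [cite: HatcherAT2002, Thm. 2C.3 (proof)] -/
theorem subsingleton_homology_of_subsingleton (i : ι) [Module.Finite K (C.X i)] [Subsingleton (C.X i)] :
    Subsingleton (C.homology i) := by
  have h := EulerPoincare.finrank_homology_le C i
  rw [Module.finrank_zero_of_subsingleton (M := C.X i), Nat.le_zero] at h
  haveI := moduleFinite_homology C i
  exact Module.finrank_zero_iff.1 h

/-- **Degreewise factorisation**: `χ(φᵢ) = χ(H(φ)ᵢ) · χ(φ_{next i} | im d(i, next i)) · χ(φᵢ | im d(prev i, i))` for `Cⁱ` finite-dimensional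
(LEAF 1 on the short complex `C.sc i`; the instance `Module.Finite K (C.homology i)` is row `HopfTraceFormula`'s `moduleFinite_homology`).
[cite: BourbakiAlgebreVIII2012, VIII §20 n°6 (p. 377)] [cite: HatcherAT2002, Thm. 2C.3 (proof)] -/
theorem charpoly_f_eq (i : ι) [Module.Finite K (C.X i)] [Module.Finite K (C.homology i)] :
    (φ.f i).hom.charpoly =
      (HomologicalComplex.homologyMap φ i).hom.charpoly *
        ((φ.f (c.next i)).hom.restrict (mapsTo_range_d C φ i (c.next i))).charpoly *
        ((φ.f i).hom.restrict (mapsTo_range_d C φ (c.prev i) i)).charpoly :=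
  haveI : Module.Finite K (C.sc i).X₂ := inferInstanceAs (Module.Finite K (C.X i))
  haveI : Module.Finite K (C.sc i).homology := inferInstanceAs (Module.Finite K (C.homology i))
  charpoly_τ₂_eq (C.sc i) ((HomologicalComplex.shortComplexFunctor _ c i).map φ)

/-! ### The alternating product in `K(X)` -/

/-- **The characteristic-polynomial Euler–Poincaré identity** (Lang XX §3 Thm. 3.1 for the Euler–Poincaré map `u ↦ χ(u)`): for an
endomorphism `φ` of a homological complex of finite-dimensional vector spaces, of any shape with `EulerCharSigns` and finitely many
non-zero terms, `∏ᶠ i, χ(φᵢ)^{χ(i)} = ∏ᶠ i, χ(H(φ)ᵢ)^{χ(i)}` in `RatFunc K`, where `χ(i) = ±1` acts as a `ℤ`-power (row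
`EulerPoincarePrinciple` in the group `(RatFunc K)ˣ`, fed by `charpoly_f_eq`). [cite: Lang2002, Ch. XX §3, Thm. 3.1] [cite: HatcherAT2002, Thm. 2C.3] -/
theorem finprod_charpoly_zpow_χ_eq [c.EulerCharSigns] [∀ i, Module.Finite K (C.X i)] [∀ i, Module.Finite K (C.homology i)]
    (hC : (GradedObject.finrankSupport C.X).Finite) :
    ∏ᶠ i, algebraMap K[X] (RatFunc K) (φ.f i).hom.charpoly ^ ((c.χ i : ℤ)) =
      ∏ᶠ i, algebraMap K[X] (RatFunc K) (HomologicalComplex.homologyMap φ i).hom.charpoly ^ ((c.χ i : ℤ)) := by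
  classical
  -- the unit of `K(X)` attached to a characteristic polynomial (monic, hence non-zero)
  have hρ : ∀ {M : Type v} [AddCommGroup M] [Module K M] [Module.Finite K M] (f : M →ₗ[K] M),
      algebraMap K[X] (RatFunc K) f.charpoly ≠ 0 := fun f =>
    (map_ne_zero_iff _ (RatFunc.algebraMap_injective K)).2 f.charpoly_monic.ne_zero
  let U : ∀ {M : Type v} [AddCommGroup M] [Module K M] [Module.Finite K M], (M →ₗ[K] M) → (RatFunc K)ˣ :=
    fun f => Units.mk0 _ (hρ f)
  have hU : ∀ {M : Type v} [AddCommGroup M] [Module K M] [Module.Finite K M] (f : M →ₗ[K] M),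
      ((U f : (RatFunc K)ˣ) : RatFunc K) = algebraMap K[X] (RatFunc K) f.charpoly := fun f => rfl
  have hU0 : ∀ {M : Type v} [AddCommGroup M] [Module K M] [Module.Finite K M] (f : M →ₗ[K] M), f.charpoly = 1 → U f = 1 :=
    fun f hf => Units.ext (by rw [hU, hf, map_one, Units.val_one])
  have hU1 : ∀ {M : Type v} [AddCommGroup M] [Module K M] [Module.Finite K M] (f : M →ₗ[K] M), Subsingleton M → U f = 1 :=
    fun f _ => hU0 f (charpoly_eq_one_of_subsingleton f)
  -- supports: every factor is `1` where `Cⁱ = 0`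
  have hsupp : ∀ (g : ι → (RatFunc K)ˣ), (∀ i, Subsingleton (C.X i) → g i = 1) → g.HasFiniteMulSupport := fun g hg =>
    hC.subset fun i hi => by
      simp only [GradedObject.finrankSupport, Function.mem_support, ne_eq]
      exact fun h0 => hi (hg i (Module.finrank_zero_iff.1 h0))
  -- the abstract Euler–Poincaré principle in `(RatFunc K)ˣ`, fed by `charpoly_f_eq`
  have total := finprod_zpow_χ_eq_of_degreewise (c := c) (fun i => U (φ.f i).hom) (fun i => U (HomologicalComplex.homologyMap φ i).hom)
    (fun i => U ((φ.f (c.next i)).hom.restrict (mapsTo_range_d C φ i (c.next i))))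
    (fun j => U ((φ.f j).hom.restrict (mapsTo_range_d C φ (c.prev j) j)))
    (fun i => Units.ext (by rw [Units.val_mul, Units.val_mul, hU, hU, hU, hU, charpoly_f_eq C φ i, map_mul, map_mul, mul_assoc]))
    (fun j hj => hU0 _ (charpoly_restrict_range_d_eq_one C φ _ _ hj)) (fun i hi => hU0 _ (charpoly_restrict_range_d_eq_one C φ _ _ hi))
    (fun i j hij => by
      have h1 : c.prev j = i := c.prev_eq' hij
      have h2 : c.next i = j := c.next_eq' hij
      subst h1
      rw [h2])
    (hsupp _ fun i _ => hU1 _ (subsingleton_homology_of_subsingleton C i))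
    (hsupp _ fun i _ => hU1 _ (by rw [Subsingleton.elim (C.d i (c.next i)).hom 0, LinearMap.range_zero]; infer_instance))
    (hsupp _ fun i _ => hU1 _ inferInstance)
  -- read the identity of `(RatFunc K)ˣ` in `RatFunc K`
  have read : ∀ {M : ι → Type v} [∀ i, AddCommGroup (M i)] [∀ i, Module K (M i)] [∀ i, Module.Finite K (M i)]
      (f : ∀ i, M i →ₗ[K] M i), (∀ i, Subsingleton (C.X i) → Subsingleton (M i)) →
      (((∏ᶠ i, U (f i) ^ ((c.χ i : ℤ)) : (RatFunc K)ˣ)) : RatFunc K) = ∏ᶠ i, algebraMap K[X] (RatFunc K) (f i).charpoly ^ ((c.χ i : ℤ)) := by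
    intro M _ _ _ f hf
    have hfs : (fun i => U (f i) ^ ((c.χ i : ℤ))).HasFiniteMulSupport := hsupp _ fun i hi => by rw [hU1 _ (hf i hi), one_zpow]
    rw [← Units.coeHom_apply, MonoidHom.map_finprod _ hfs]
    exact finprod_congr fun i => by rw [map_zpow, Units.coeHom_apply, hU]
  rw [← read (fun i => (φ.f i).hom) (fun _ h => h),
    ← read (fun i => (HomologicalComplex.homologyMap φ i).hom) fun i _ => subsingleton_homology_of_subsingleton C i]
  exact congrArg _ total

/-- **`Finset` form**: if the non-zero terms of `C` have indices in `s`, `∏_{i ∈ s} χ(φᵢ)^{χ(i)} = ∏_{i ∈ s} χ(H(φ)ᵢ)^{χ(i)}` in `RatFunc K`.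
[cite: Lang2002, Ch. XX §3, Thm. 3.1] -/
theorem prod_charpoly_zpow_χ_eq [c.EulerCharSigns] [∀ i, Module.Finite K (C.X i)] [∀ i, Module.Finite K (C.homology i)] (s : Finset ι)
    (hs : GradedObject.finrankSupport C.X ⊆ s) :
    ∏ i ∈ s, algebraMap K[X] (RatFunc K) (φ.f i).hom.charpoly ^ ((c.χ i : ℤ)) =
      ∏ i ∈ s, algebraMap K[X] (RatFunc K) (HomologicalComplex.homologyMap φ i).hom.charpoly ^ ((c.χ i : ℤ)) := by
  have h0 : ∀ i, i ∉ (s : Set ι) → Subsingleton (C.X i) := fun i hi => by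
    by_contra h
    exact hi (hs (by simpa [GradedObject.finrankSupport, Module.finrank_zero_iff] using h))
  rw [← finprod_eq_prod_of_mulSupport_subset _ (fun i hi => ?_), ← finprod_eq_prod_of_mulSupport_subset _ (fun i hi => ?_),
    finprod_charpoly_zpow_χ_eq C φ (s.finite_toSet.subset hs)]
  · by_contra hni
    haveI := h0 i hni
    haveI := subsingleton_homology_of_subsingleton C i
    exact hi (by simp only [charpoly_eq_one_of_subsingleton, map_one, one_zpow])
  · by_contra hni
    haveI := h0 i hni
    exact hi (by simp only [charpoly_eq_one_of_subsingleton, map_one, one_zpow])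

end Literature.Algebra.Homology.HopfTrace

/-- **`ℤ`-indexed cochain form**: for an endomorphism `φ` of a cochain complex of finite-dimensional spaces vanishing outside `[a, b]`,
`∏_{n=a}^{b} χ(φⁿ)^{(−1)ⁿ} = ∏_{n=a}^{b} χ(Hⁿ(φ))^{(−1)ⁿ}` in `RatFunc K` — the linear algebra behind `Z = ∏ Pᵣ^{(−1)^{r+1}}`.
[cite: Lang2002, Ch. XX §3, Thm. 3.1] [cite: HatcherAT2002, Thm. 2C.3] -/
theorem Literature.Algebra.Homology.CochainComplex.prod_charpoly_zpow_negOnePow_eq {K : Type u} [Field K]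
    (C : CochainComplex (ModuleCat.{v} K) ℤ) (φ : C ⟶ C) [∀ n, Module.Finite K (C.X n)] [∀ n, Module.Finite K (C.homology n)]
    (a b : ℤ) (hC : ∀ n, n ∉ Finset.Icc a b → IsZero (C.X n)) :
    ∏ n ∈ Finset.Icc a b, algebraMap K[X] (RatFunc K) (φ.f n).hom.charpoly ^ ((n.negOnePow : ℤ)) =
      ∏ n ∈ Finset.Icc a b, algebraMap K[X] (RatFunc K) (HomologicalComplex.homologyMap φ n).hom.charpoly ^ ((n.negOnePow : ℤ)) := by
  have hsupp : GradedObject.finrankSupport C.X ⊆ (Finset.Icc a b : Finset ℤ) := by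
    intro n hn
    by_contra hn'
    haveI := ModuleCat.subsingleton_of_isZero (hC n hn')
    exact hn Module.finrank_zero_of_subsingleton
  simpa using Literature.Algebra.Homology.HopfTrace.prod_charpoly_zpow_χ_eq C φ (Finset.Icc a b) hsupp
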